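import Summits.QuantumFields.YangMills.Theorems.SwapVirialDeficitBlowUpGnomonicEulerIdentity
import HarnessLib

/-!
# THE AMPLITUDE DATUM OF THE GNOMONIC DENSITY: `gnoDensity η = w₀(p)·(1 + e)`, `ℓ = 0`, `−2·Q_fib(η) ≤ e ≤ 0` — the «amplitude» bullet of (B-bulk)
# (free-hands support of ⟨stmt-QuantumFields-24197⟩ `SwapVirialDeficit.SwapGluedStiffness`; LEAD ym-line-sfw-p2 g97's steep-window Morse–Bott plan §1 (B-bulk):
# «gnoDensity = ∏(1+|v|²)^{−2}-type ⟹ w = w₀(p)(1 + e), ℓ = 0, |e| ≤ 2‖y‖² (G = 2, D = 0)»)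

Base∕fibre split of the gnomonic coordinates `η = ((x, y), z, η_F)` (✓`BlowUpRing.GnoCoord`): base = the axial components `x₀, y₀` (and the hub, signs), fibre = the
Euler-dilated components `x_⊥ = (x₁,x₂)`, `y_⊥`, `z`, `η_F` (✓`eulerDilate t` scales exactly these; `eulerDilate 0 η` is the base point under `η`).  With the FIBRE GAUGE
`Q_fib(η) := x₁² + x₂² + y₁² + y₂² + |z|² + Σ_f |η_f|²` (homogeneous of degree 2 under `eulerDilate`, ★ `fibreSq_eulerDilate`) the density ✓`gnoDensity η = ∏_{x,y,z} w · ∏_f w`,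
`w(v) = (1+|v|²)^{−2}`, satisfies
* ★ `gnoDensity_eulerDilate_zero` — `w₀(p) := gnoDensity (eulerDilate 0 η) = w(x₀e₀)·w(y₀e₀)`;
* ★★★ `gnoDensity_amplitude` — `w₀(p)·(1 − 2·Q_fib(η)) ≤ gnoDensity η ≤ w₀(p)`; ★★ `abs_gnoDensity_sub_le` — `|gnoDensity η − w₀(p)| ≤ 2·Q_fib(η)·w₀(p)`: the `hwT` hypothesis of
  ✓`QuantitativeLaplace.laplaceMethod_quantitative_fibred_of_taylor` with `lam' = 0`, `N₁ = 0`, `N₂ = 2` (in any fibre norm with `‖y‖² ≥ Q_fib`), EVERY base point, no smallness;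
* the letters: `one_sub_two_mul_le_gnomonicWeight` (`1 − 2|v|² ≤ w(v)`), ★ `gnomonicWeight_axial_bounds` (`w(x₀e₀)(1 − 2|x_⊥|²) ≤ w(x) ≤ w(x₀e₀)`),
  `piWeight_ge_one_sub` (Weierstrass' product inequality `1 − ∏aᵢ ≤ Σ(1 − aᵢ)` along the followers).

HONEST LABEL: elementary inequalities on the chart density; ⟨24197⟩ (window-uniform) ∕ ⟨24196⟩ ∕ ⟨24194⟩ ∕ ⟨24497⟩ OPEN; own crux ⟨22884⟩ OPEN (blocked-on ⟨19935⟩); no crux, rung of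
record or summit is proved; the Yang–Mills mass gap is NOT proved; no summit is proved by a line.  THEOREMS ONLY (0 `def`, 0 `sorry`), standard axioms.
Width seat ym-line-sfw-p2-w3 g65 (cell ym-idea-1, free hands), `--supports stmt-QuantumFields-24197`.  References: [folklore].
-/

set_option autoImplicit false

noncomputable section

open scoped BigOperators
open Literature.MathematicalPhysics.QuantumFieldTheory hiding SU2
open Literature.MathematicalPhysics.QuantumLattice

namespace Summit.QuantumFields.YangMills.Theorems.SwapVirialDeficit.BlowUpRing

open Summit.QuantumFields.YangMills.Theorems.FemtoTransferGap
open Summit.QuantumFields.YangMills.Theorems.SwapVirialDeficit.Gnomonic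

variable {L : ℕ} [NeZero L]

/-! ## §1 Letters: Weierstrass' product inequality and the one-letter weight -/

omit [NeZero L] in
/-- `1 − 2|v|² ≤ w(v) = (1+|v|²)^{−2}`. [folklore] -/
theorem one_sub_two_mul_le_gnomonicWeight (v : Fin 3 → ℝ) : 1 - 2 * normSq3 v ≤ gnomonicWeight v := by
  have ht := normSq3_nonneg v
  set t := normSq3 v with htdef
  rw [gnomonicWeight, ← htdef, inv_pow, ← one_div, le_div_iff₀ (by positivity)]
  nlinarith [sq_nonneg t, mul_nonneg ht (sq_nonneg t)]

omit [NeZero L] in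
/-- `|trDil 0 v|² = v₀²` (the axial component only). [folklore] -/
theorem normSq3_trDil_zero (v : Fin 3 → ℝ) : normSq3 (trDil 0 v) = v 0 ^ 2 := by
  simp [normSq3, trDil, Fin.sum_univ_three]

omit [NeZero L] in
/-- ★ **The leader letter's weight against its axial value**: `w(x₀e₀)·(1 − 2|x_⊥|²) ≤ w(x) ≤ w(x₀e₀)` with `x₀e₀ = trDil 0 x`. [folklore] -/
theorem gnomonicWeight_axial_bounds (v : Fin 3 → ℝ) :
    gnomonicWeight (trDil 0 v) * (1 - 2 * (v 1 ^ 2 + v 2 ^ 2)) ≤ gnomonicWeight v ∧ gnomonicWeight v ≤ gnomonicWeight (trDil 0 v) := by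
  have hT : 0 ≤ v 1 ^ 2 + v 2 ^ 2 := by positivity
  set T := v 1 ^ 2 + v 2 ^ 2 with hTdef
  have ha : 1 ≤ 1 + v 0 ^ 2 := by nlinarith [sq_nonneg (v 0)]
  set a := 1 + v 0 ^ 2 with hadef
  have e1 : gnomonicWeight (trDil 0 v) = (a⁻¹) ^ 2 := by rw [gnomonicWeight, normSq3_trDil_zero]
  have e2 : gnomonicWeight v = ((a + T)⁻¹) ^ 2 := by rw [gnomonicWeight, normSq3_eq_three, ← hTdef, ← add_assoc]
  rw [e1, e2]
  have ha0 : 0 < a := by linarith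
  have haT : 0 < a + T := by linarith
  constructor
  · -- `a⁻²(1 − 2T) ≤ (a+T)⁻²`
    rw [inv_pow, inv_pow, ← one_div, ← one_div, div_mul_eq_mul_div, one_mul, div_le_div_iff₀ (by positivity) (by positivity), one_mul]
    nlinarith [mul_nonneg hT (sq_nonneg T), mul_nonneg (sub_nonneg.2 ha) hT, mul_nonneg (mul_nonneg ha0.le hT) hT, sq_nonneg a, mul_nonneg ha0.le hT]
  · -- `(a+T)⁻² ≤ a⁻²`
    have h : (a + T)⁻¹ ≤ a⁻¹ := inv_anti₀ ha0 (by linarith)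
    exact pow_le_pow_left₀ (inv_nonneg.2 haT.le) h 2

omit [NeZero L] in
/-- ★ The follower product weight: `1 − 2·Σ_f |η_f|² ≤ ∏_f w(η_f) ≤ 1`. [folklore] -/
theorem piWeight_ge_one_sub {ι : Type*} [Fintype ι] (η : ι → Fin 3 → ℝ) : 1 - 2 * ∑ i, normSq3 (η i) ≤ piWeight η := by
  classical
  -- Weierstrass' product inequality along `Finset.induction`, specialised to the one-letter weights
  have key : ∀ s : Finset ι, 1 - 2 * ∑ i ∈ s, normSq3 (η i) ≤ ∏ i ∈ s, gnomonicWeight (η i) := by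
    intro s
    induction s using Finset.induction_on with
    | empty => simp
    | @insert j s hj ih =>
      rw [Finset.prod_insert hj, Finset.sum_insert hj]
      have hP1 : ∏ i ∈ s, gnomonicWeight (η i) ≤ 1 := Finset.prod_le_one (fun i _ => (gnomonicWeight_pos _).le) fun i _ => gnomonicWeight_le_one _
      have hP0 : 0 ≤ ∏ i ∈ s, gnomonicWeight (η i) := Finset.prod_nonneg fun i _ => (gnomonicWeight_pos _).le
      have hw1 := gnomonicWeight_le_one (η j)
      have hw2 := one_sub_two_mul_le_gnomonicWeight (η j)
      nlinarith [mul_nonneg (sub_nonneg.2 hw1) (sub_nonneg.2 hP1)]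
  rw [piWeight]; exact key Finset.univ

/-! ## §2 The base point under `η` and the fibre gauge -/

/-- ★ **The density at the base point**: `gnoDensity (eulerDilate 0 η) = w(x₀e₀)·w(y₀e₀)` (the `z` letter and all followers sit at their references). [folklore] -/
theorem gnoDensity_eulerDilate_zero (η : GnoCoord L) :
    gnoDensity (eulerDilate 0 η) = gnomonicWeight (trDil 0 η.1.1) * gnomonicWeight (trDil 0 η.1.2) := by
  have h0 : gnomonicWeight (0 : Fin 3 → ℝ) = 1 := by simp [gnomonicWeight, normSq3]
  have hP : piWeight (fun _ : Fol L => (0 : Fin 3 → ℝ)) = 1 := by simp [piWeight, h0]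
  simp only [gnoDensity, eulerDilate, zero_smul]
  rw [h0, mul_one, hP, mul_one]

/-- ★ **The fibre gauge is homogeneous of degree two under the Euler dilation**:
`Q_fib(eulerDilate t η) = t²·Q_fib(η)`, `Q_fib(η) = x₁² + x₂² + y₁² + y₂² + |z|² + Σ_f|η_f|²`. [folklore] -/
theorem fibreSq_eulerDilate (t : ℝ) (η : GnoCoord L) :
    ((eulerDilate t η).1.1 1 ^ 2 + (eulerDilate t η).1.1 2 ^ 2 + ((eulerDilate t η).1.2 1 ^ 2 + (eulerDilate t η).1.2 2 ^ 2) +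
        normSq3 (eulerDilate t η).2.1 + ∑ f, normSq3 ((eulerDilate t η).2.2 f)) =
      t ^ 2 * (η.1.1 1 ^ 2 + η.1.1 2 ^ 2 + (η.1.2 1 ^ 2 + η.1.2 2 ^ 2) + normSq3 η.2.1 + ∑ f, normSq3 (η.2.2 f)) := by
  simp only [eulerDilate, trDil, normSq3_smul, Matrix.cons_val_zero, Matrix.cons_val_one, Matrix.cons_val_two, Matrix.head_cons, Matrix.tail_cons]
  rw [← Finset.mul_sum]
  ring

omit [NeZero L] in
/-- The base point does not see the fibre: `eulerDilate 0 (eulerDilate t η) = eulerDilate 0 η`. [folklore] -/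
theorem eulerDilate_zero_eulerDilate (t : ℝ) (η : GnoCoord L) : eulerDilate 0 (eulerDilate t η) = eulerDilate 0 η := by
  rw [eulerDilate_eulerDilate, zero_mul]

/-! ## §3 The amplitude datum -/

/-- ★★★ **THE AMPLITUDE DATUM OF THE GNOMONIC DENSITY** (`ℓ = 0`, `G = 2`, `D = 0`): for every `η`,
`gnoDensity(eulerDilate 0 η)·(1 − 2·Q_fib(η)) ≤ gnoDensity η ≤ gnoDensity(eulerDilate 0 η)` with `Q_fib(η) = x₁² + x₂² + y₁² + y₂² + |z|² + Σ_f|η_f|²` — the density is its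
base value times an EVEN factor `1 + e(η) ∈ [1 − 2Q_fib, 1]`. [folklore] -/
theorem gnoDensity_amplitude (η : GnoCoord L) :
    gnoDensity (eulerDilate 0 η) * (1 - 2 * (η.1.1 1 ^ 2 + η.1.1 2 ^ 2 + (η.1.2 1 ^ 2 + η.1.2 2 ^ 2) + normSq3 η.2.1 + ∑ f, normSq3 (η.2.2 f))) ≤
        gnoDensity η ∧
      gnoDensity η ≤ gnoDensity (eulerDilate 0 η) := by
  rw [gnoDensity_eulerDilate_zero]
  obtain ⟨hx1, hx2⟩ := gnomonicWeight_axial_bounds η.1.1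
  obtain ⟨hy1, hy2⟩ := gnomonicWeight_axial_bounds η.1.2
  have hz1 := one_sub_two_mul_le_gnomonicWeight η.2.1
  have hz2 := gnomonicWeight_le_one η.2.1
  have hF1 := piWeight_ge_one_sub η.2.2
  have hF2 := piWeight_le_one η.2.2
  have hA0 := gnomonicWeight_pos (trDil 0 η.1.1)
  have hB0 := gnomonicWeight_pos (trDil 0 η.1.2)
  have hA := gnomonicWeight_pos η.1.1
  have hB := gnomonicWeight_pos η.1.2
  have hC := gnomonicWeight_pos η.2.1
  have hD := piWeight_pos η.2.2
  set A₀ := gnomonicWeight (trDil 0 η.1.1)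
  set B₀ := gnomonicWeight (trDil 0 η.1.2)
  set A := gnomonicWeight η.1.1
  set B := gnomonicWeight η.1.2
  set C := gnomonicWeight η.2.1
  set D := piWeight η.2.2
  set sx := η.1.1 1 ^ 2 + η.1.1 2 ^ 2
  set sy := η.1.2 1 ^ 2 + η.1.2 2 ^ 2
  set sz := normSq3 η.2.1
  set sF := ∑ f, normSq3 (η.2.2 f)
  -- ratios in `[0, 1]`
  set a := A / A₀ with hadef
  set b := B / B₀ with hbdef
  have haA : A = A₀ * a := by rw [hadef]; field_simp
  have hbB : B = B₀ * b := by rw [hbdef]; field_simp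
  have ha1 : a ≤ 1 := by rw [hadef, div_le_one hA0]; exact hx2
  have hb1 : b ≤ 1 := by rw [hbdef, div_le_one hB0]; exact hy2
  have ha0 : 0 ≤ a := by rw [hadef]; positivity
  have hb0 : 0 ≤ b := by rw [hbdef]; positivity
  have ha2 : 1 - a ≤ 2 * sx := by
    have : A₀ * (1 - 2 * sx) ≤ A₀ * a := by rw [← haA]; exact hx1
    have := le_of_mul_le_mul_left this hA0
    linarith
  have hb2 : 1 - b ≤ 2 * sy := by
    have : B₀ * (1 - 2 * sy) ≤ B₀ * b := by rw [← hbB]; exact hy1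
    have := le_of_mul_le_mul_left this hB0
    linarith
  have hc2 : 1 - C ≤ 2 * sz := by linarith
  have hd2 : 1 - D ≤ 2 * sF := by linarith
  -- Weierstrass, four factors: `1 − uv ≤ (1 − u) + (1 − v)` for `u, v ≤ 1`
  have hab1 : a * b ≤ 1 := mul_le_one₀ ha1 hb0 hb1
  have habC1 : a * b * C ≤ 1 := mul_le_one₀ hab1 hC.le hz2
  have hab : 1 - a * b ≤ (1 - a) + (1 - b) := by nlinarith [mul_nonneg (sub_nonneg.2 ha1) (sub_nonneg.2 hb1)]
  have habC : 1 - a * b * C ≤ (1 - a * b) + (1 - C) := by nlinarith [mul_nonneg (sub_nonneg.2 hab1) (sub_nonneg.2 hz2)]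
  have habCD : 1 - a * b * C * D ≤ (1 - a * b * C) + (1 - D) := by nlinarith [mul_nonneg (sub_nonneg.2 habC1) (sub_nonneg.2 hF2)]
  have hprod : 1 - 2 * (sx + sy + sz + sF) ≤ a * b * C * D := by linarith
  have hdens : gnoDensity η = A₀ * B₀ * (a * b * C * D) := by
    simp only [gnoDensity]
    rw [show gnomonicWeight η.1.1 = A from rfl, show gnomonicWeight η.1.2 = B from rfl, haA, hbB]; ring
  rw [hdens]
  constructor
  · have h := mul_le_mul_of_nonneg_left hprod (mul_pos hA0 hB0).le
    have e : sx + sy + sz + sF = sx + (η.1.2 1 ^ 2 + η.1.2 2 ^ 2) + sz + sF := rfl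
    linarith [h]
  · have h1 : a * b * C * D ≤ 1 := mul_le_one₀ habC1 hD.le hF2
    have := mul_le_mul_of_nonneg_left h1 (mul_pos hA0 hB0).le
    linarith

/-- ★★ **`|gnoDensity η − w₀(p)| ≤ 2·Q_fib(η)·w₀(p)`**, `w₀(p) = gnoDensity (eulerDilate 0 η)`: the `hwT` hypothesis of ✓`laplaceMethod_quantitative_fibred_of_taylor`
(`lam' = 0`, `N₁ = 0`, `N₂ = 2` for any fibre norm with `‖y‖² ≥ Q_fib`), at EVERY base point, with no smallness condition. [folklore] -/
theorem abs_gnoDensity_sub_le (η : GnoCoord L) :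
    |gnoDensity η - gnoDensity (eulerDilate 0 η)| ≤
      2 * (η.1.1 1 ^ 2 + η.1.1 2 ^ 2 + (η.1.2 1 ^ 2 + η.1.2 2 ^ 2) + normSq3 η.2.1 + ∑ f, normSq3 (η.2.2 f)) * gnoDensity (eulerDilate 0 η) := by
  obtain ⟨h1, h2⟩ := gnoDensity_amplitude η
  rw [abs_le]
  constructor <;> nlinarith [h1, h2]

/-- ★ The same in the `(1 + e)`-form: `∃ e, gnoDensity η = gnoDensity(eulerDilate 0 η)·(1 + e) ∧ −2Q_fib(η) ≤ e ≤ 0`. [folklore] -/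
theorem exists_gnoDensity_eq_mul_one_add (η : GnoCoord L) :
    ∃ e : ℝ, gnoDensity η = gnoDensity (eulerDilate 0 η) * (1 + e) ∧
      -(2 * (η.1.1 1 ^ 2 + η.1.1 2 ^ 2 + (η.1.2 1 ^ 2 + η.1.2 2 ^ 2) + normSq3 η.2.1 + ∑ f, normSq3 (η.2.2 f))) ≤ e ∧ e ≤ 0 := by
  obtain ⟨h1, h2⟩ := gnoDensity_amplitude η
  have h0 : 0 < gnoDensity (eulerDilate 0 η) := by
    rw [gnoDensity_eulerDilate_zero]; exact mul_pos (gnomonicWeight_pos _) (gnomonicWeight_pos _)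
  refine ⟨gnoDensity η / gnoDensity (eulerDilate 0 η) - 1, by field_simp; ring, ?_, ?_⟩
  · rw [le_sub_iff_add_le, le_div_iff₀ h0]; linarith
  · rw [sub_nonpos, div_le_one h0]; exact h2

end Summit.QuantumFields.YangMills.Theorems.SwapVirialDeficit.BlowUpRing

end
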